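import Literature.Analysis.FluidPDE.TorusClassicalH1Balance
import Literature.Analysis.FunctionSpaces.TorusEnstrophyTrilinear
import Literature.Analysis.FunctionSpaces.TorusSobolevSup
import Literature.Analysis.FunctionSpaces.TorusTrilinearH1
import HarnessLib

/-!
# Stub `stub_h2NonlinearEstimate` of the line `SketchIdeator2` (card `separatrix-flux-pinning`)
# (crux stmt-AnomalousDissipation-14249, `MarginalStabilityChain.ChainRealisation`)

The **`H²` nonlinear estimate on `T³`**: for every `ν > 0` and `M ≥ 0` there is `C = C(ν, M)`
such that for every smooth solenoidal mean-zero `u : T³ → ℝ³` with `‖∇u‖₂² ≤ M`,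
`|∫ ⟪(u·∇)u, Δ²u⟫| ≤ (ν/2) ‖∇Δu‖₂² + C (1 + ‖Δu‖₂²)²`
(`gradNormSq (laplacian u) = ‖∇Δu‖₂²`).  This is the inequality closing the `H²` energy estimate
`d/dt ½‖Δu‖² = −ν‖∇Δu‖² − ∫⟪(u·∇)u − F, Δ²u⟫` of the three-dimensional Navier–Stokes equations on
the torus at fixed viscosity (Constantin–Foias 1988, Ch. 13; Foias–Manley–Rosa–Temam 2001,
Ch. II App. A §A.4), with constants depending on `ν` and the enstrophy bound `M`.

Proof (write `A = (u·∇)u`, `B = Δu`, `L = ‖Δu‖₂²`, `θ = ∑ᵢ ‖∂ᵢu‖²`):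
1. Green: `∫ ⟪A, ΔB⟫ = −∑ₘ ∫ ⟪∂ₘA, ∂ₘB⟫`
   (`Torus.sum_integral_inner_partialDeriv_eq_neg_integral_inner_laplacian`).
2. Pointwise Young: `|∑ₘ ⟪∂ₘA, ∂ₘB⟫| ≤ (ν/2) ∑ₘ ‖∂ₘB‖² + (1/2ν) ∑ₘ ‖∂ₘA‖²`; integrating, the
   first term is `(ν/2) gradNormSq (Δu)`.
3. Product rule `∂ₘA = ∑ᵢ (uᵢ ∂ₘ∂ᵢu + (∂ₘu)ᵢ ∂ᵢu)` (`Torus.partialDeriv_convect_self`) and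
   `(∑ᵢ cᵢ)² ≤ 3 ∑ᵢ cᵢ²`: `∑ₘ ‖∂ₘA‖² ≤ 6 (‖u‖² ∑ₘ∑ᵢ ‖∂ᵢ∂ₘu‖² + θ²)` pointwise.
4. `‖u x‖² ≤ K₂ (‖u‖₂² + ‖∇u‖₂² + ∑∑‖∂ᵢ∂ⱼu‖₂²) ≤ K₂ (28 M + L)` (the Sobolev embedding
   `Torus.norm_sq_le_sobolev_two_of_isSmooth`, Poincaré–Wirtinger
   `Torus.integral_norm_sq_le_card_pow_mul_gradNormSq` for the mean-zero `u`, and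
   `∑ₘ ‖∇∂ₘu‖₂² = ‖Δu‖₂²`, `Torus.sum_gradNormSq_partialDeriv_eq`), and Ladyzhenskaya
   `∫ θ² ≤ K₁ ‖∇u‖₂ ‖Δu‖₂³` (`Torus.integral_sum_norm_sq_partialDeriv_sq_le`), so
   `∫ ∑ₘ ‖∂ₘA‖² ≤ 6 K₂ (28M + L) L + 6 K₁ M^{1/2} L^{3/2} ≤ 6 (K₂ (28M+1) + K₁ M^{1/2}) (1 + L)²`.
The divergence-free hypothesis is not used.

The statement is the registered stub verbatim, over the skeleton's local notations
`𝕋³ = UnitAddTorus (Fin 3)`, `E³ = EuclideanSpace ℝ (Fin 3)`; `laplacian`, `convect`, `gradNormSq`,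
`partialDeriv`, `IsSmooth`, `IsDivFree`, `HasZeroMean` are the torus notions of
`Literature.Analysis.FunctionSpaces.Torus` (checked by the `example`s below).

References: P. Constantin, C. Foias, *Navier–Stokes Equations*, Univ. Chicago Press 1988, Ch. 13;
C. Foias, O. Manley, R. Rosa, R. Temam, *Navier–Stokes Equations and Turbulence*, CUP 2001,
Ch. II App. A §A.4.
-/

-- `Summit.<Summit>.<Problem>` is the tree's mandated summit-side namespace (CONVENTIONS §2); for this
-- single-conjunct summit the two coincide, so the duplicate is deliberate.
set_option linter.dupNamespace false

noncomputable section

open MeasureTheory Set Filter Topology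
open scoped InnerProductSpace
open Literature.Analysis.FunctionSpaces Literature.Analysis.FunctionSpaces.Torus
open Literature.Analysis.FluidPDE

namespace Summit.AnomalousDissipation.AnomalousDissipation.Theorems.ChainRealisation.SeparatrixFluxPinning

/-- Local notation (as in the skeleton): the torus `T³`. -/
local notation "𝕋³" => UnitAddTorus (Fin 3)
/-- Local notation (as in the skeleton): velocity values. -/
local notation "E³" => EuclideanSpace ℝ (Fin 3)

/-- Sanity check: with the opens above, `laplacian` on torus fields is `Torus.laplacian`. -/
example : (laplacian : (𝕋³ → E³) → 𝕋³ → E³) = Torus.laplacian := rfl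

/-- Sanity check: with the opens above, `convect` on torus fields is `Torus.convect`. -/
example : (convect : (𝕋³ → E³) → (𝕋³ → E³) → 𝕋³ → E³) = Torus.convect := rfl

/-- Sanity check: with the opens above, `gradNormSq` is `Torus.gradNormSq`. -/
example : (gradNormSq : (𝕋³ → E³) → ℝ) = Torus.gradNormSq := rfl

/-- Young's inequality in the form `a b ≤ (ν/2) b² + a²/(2ν)` for `ν > 0`. -/
theorem h2NL_young {ν : ℝ} (hν : 0 < ν) (a b : ℝ) :
    a * b ≤ ν / 2 * b ^ 2 + 1 / (2 * ν) * a ^ 2 := by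
  have key : ν / 2 * b ^ 2 + 1 / (2 * ν) * a ^ 2 - a * b = (ν * b - a) ^ 2 / (2 * ν) := by
    field_simp
    ring
  have h0 : 0 ≤ (ν * b - a) ^ 2 / (2 * ν) := by positivity
  linarith

/-- `‖∑ᵢ cᵢ‖² ≤ (card ι) ∑ᵢ ‖cᵢ‖²` in a seminormed group (triangle inequality and Cauchy–Schwarz
for finite sums). -/
theorem h2NL_norm_sum_sq_le {ι G : Type*} [Fintype ι] [SeminormedAddCommGroup G] (c : ι → G) :
    ‖∑ i, c i‖ ^ 2 ≤ Fintype.card ι * ∑ i, ‖c i‖ ^ 2 := by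
  calc ‖∑ i, c i‖ ^ 2 ≤ (∑ i, ‖c i‖) ^ 2 := pow_le_pow_left₀ (norm_nonneg _) (norm_sum_le _ _) 2
    _ ≤ Fintype.card ι * ∑ i, ‖c i‖ ^ 2 := by
        have h := sq_sum_le_card_mul_sum_sq (s := (Finset.univ : Finset ι)) (f := fun i => ‖c i‖)
        rwa [Finset.card_univ] at h

/-- **Pointwise bound of `∂ₘ((u·∇)u)`**: by the product rule
`∂ₘ((u·∇)u) = ∑ᵢ (uᵢ ∂ₘ∂ᵢu + (∂ₘu)ᵢ ∂ᵢu)`, `|vᵢ| ≤ ‖v‖`, `(∑ᵢ cᵢ)² ≤ 3 ∑ᵢ cᵢ²` and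
`(p + q)² ≤ 2 (p² + q²)`,
`‖∂ₘ((u·∇)u)(x)‖² ≤ 6 (‖u x‖² ∑ᵢ ‖∂ₘ∂ᵢu x‖² + ‖∂ₘu x‖² ∑ᵢ ‖∂ᵢu x‖²)`. -/
theorem h2NL_norm_partialDeriv_convect_sq_le {u : 𝕋³ → E³} (hu : IsSmooth u) (m : Fin 3) (x : 𝕋³) :
    ‖partialDeriv m (convect u u) x‖ ^ 2 ≤
      6 * (‖u x‖ ^ 2 * ∑ i, ‖partialDeriv m (partialDeriv i u) x‖ ^ 2 +
        ‖partialDeriv m u x‖ ^ 2 * ∑ i, ‖partialDeriv i u x‖ ^ 2) := by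
  rw [partialDeriv_convect_self hu m x]
  have h2 : ∀ i, ‖u x i • partialDeriv m (partialDeriv i u) x + partialDeriv m u x i • partialDeriv i u x‖ ^ 2 ≤
      2 * (‖u x‖ ^ 2 * ‖partialDeriv m (partialDeriv i u) x‖ ^ 2 +
        ‖partialDeriv m u x‖ ^ 2 * ‖partialDeriv i u x‖ ^ 2) := by
    intro i
    have ha : ‖u x i • partialDeriv m (partialDeriv i u) x‖ ≤
        ‖u x‖ * ‖partialDeriv m (partialDeriv i u) x‖ := by
      rw [norm_smul]
      exact mul_le_mul_of_nonneg_right (PiLp.norm_apply_le (u x) i) (norm_nonneg _)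
    have hb : ‖partialDeriv m u x i • partialDeriv i u x‖ ≤
        ‖partialDeriv m u x‖ * ‖partialDeriv i u x‖ := by
      rw [norm_smul]
      exact mul_le_mul_of_nonneg_right (PiLp.norm_apply_le (partialDeriv m u x) i) (norm_nonneg _)
    have hp : 0 ≤ ‖u x‖ * ‖partialDeriv m (partialDeriv i u) x‖ := by positivity
    have hq : 0 ≤ ‖partialDeriv m u x‖ * ‖partialDeriv i u x‖ := by positivity
    have hc := (norm_add_le _ _).trans (add_le_add ha hb)
    calc ‖u x i • partialDeriv m (partialDeriv i u) x + partialDeriv m u x i • partialDeriv i u x‖ ^ 2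
        ≤ (‖u x‖ * ‖partialDeriv m (partialDeriv i u) x‖ +
            ‖partialDeriv m u x‖ * ‖partialDeriv i u x‖) ^ 2 :=
          pow_le_pow_left₀ (norm_nonneg _) hc 2
      _ ≤ 2 * (‖u x‖ ^ 2 * ‖partialDeriv m (partialDeriv i u) x‖ ^ 2 +
            ‖partialDeriv m u x‖ ^ 2 * ‖partialDeriv i u x‖ ^ 2) := by
          nlinarith [sq_nonneg (‖u x‖ * ‖partialDeriv m (partialDeriv i u) x‖ -
            ‖partialDeriv m u x‖ * ‖partialDeriv i u x‖)]
  have h1 := h2NL_norm_sum_sq_le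
    (fun i => u x i • partialDeriv m (partialDeriv i u) x + partialDeriv m u x i • partialDeriv i u x)
  rw [Fintype.card_fin] at h1
  calc ‖∑ i, (u x i • partialDeriv m (partialDeriv i u) x + partialDeriv m u x i • partialDeriv i u x)‖ ^ 2
      ≤ ((3 : ℕ) : ℝ) * ∑ i, ‖u x i • partialDeriv m (partialDeriv i u) x +
          partialDeriv m u x i • partialDeriv i u x‖ ^ 2 := h1
    _ ≤ ((3 : ℕ) : ℝ) * ∑ i, 2 * (‖u x‖ ^ 2 * ‖partialDeriv m (partialDeriv i u) x‖ ^ 2 +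
          ‖partialDeriv m u x‖ ^ 2 * ‖partialDeriv i u x‖ ^ 2) := by
        gcongr with i _
        exact h2 i
    _ = 6 * (‖u x‖ ^ 2 * ∑ i, ‖partialDeriv m (partialDeriv i u) x‖ ^ 2 +
          ‖partialDeriv m u x‖ ^ 2 * ∑ i, ‖partialDeriv i u x‖ ^ 2) := by
        rw [← Finset.mul_sum, Finset.sum_add_distrib, ← Finset.mul_sum, ← Finset.mul_sum]
        push_cast
        ring

/-- **Summed pointwise bound**: `∑ₘ ‖∂ₘ((u·∇)u)(x)‖² ≤ 6 (‖u x‖² ∑ₘ∑ᵢ ‖∂ᵢ∂ₘu x‖² + θ(x)²)`,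
`θ = ∑ᵢ ‖∂ᵢu‖²`. -/
theorem h2NL_sum_norm_partialDeriv_convect_sq_le {u : 𝕋³ → E³} (hu : IsSmooth u) (x : 𝕋³) :
    ∑ m, ‖partialDeriv m (convect u u) x‖ ^ 2 ≤
      6 * (‖u x‖ ^ 2 * ∑ m, ∑ i, ‖partialDeriv i (partialDeriv m u) x‖ ^ 2 +
        (∑ i, ‖partialDeriv i u x‖ ^ 2) ^ 2) := by
  have hcomm : ∑ m, ∑ i, ‖partialDeriv m (partialDeriv i u) x‖ ^ 2 =
      ∑ m, ∑ i, ‖partialDeriv i (partialDeriv m u) x‖ ^ 2 := Finset.sum_comm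
  have eS : ∑ m, ‖u x‖ ^ 2 * ∑ i, ‖partialDeriv m (partialDeriv i u) x‖ ^ 2 =
      ‖u x‖ ^ 2 * ∑ m, ∑ i, ‖partialDeriv m (partialDeriv i u) x‖ ^ 2 := (Finset.mul_sum _ _ _).symm
  have eT : ∑ m, ‖partialDeriv m u x‖ ^ 2 * ∑ i, ‖partialDeriv i u x‖ ^ 2 =
      (∑ m, ‖partialDeriv m u x‖ ^ 2) * ∑ i, ‖partialDeriv i u x‖ ^ 2 := (Finset.sum_mul _ _ _).symm
  calc ∑ m, ‖partialDeriv m (convect u u) x‖ ^ 2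
      ≤ ∑ m, 6 * (‖u x‖ ^ 2 * ∑ i, ‖partialDeriv m (partialDeriv i u) x‖ ^ 2 +
          ‖partialDeriv m u x‖ ^ 2 * ∑ i, ‖partialDeriv i u x‖ ^ 2) :=
        Finset.sum_le_sum fun m _ => h2NL_norm_partialDeriv_convect_sq_le hu m x
    _ = 6 * (‖u x‖ ^ 2 * ∑ m, ∑ i, ‖partialDeriv i (partialDeriv m u) x‖ ^ 2 +
          (∑ i, ‖partialDeriv i u x‖ ^ 2) ^ 2) := by
        rw [← Finset.mul_sum, Finset.sum_add_distrib, eS, eT, hcomm]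
        ring

/-- **Integrated bound**: if `‖u x‖² ≤ S` everywhere then
`∫ ∑ₘ ‖∂ₘ((u·∇)u)‖² ≤ 6 S ‖Δu‖₂² + 6 ∫ θ²` (`∑ₘ ‖∇∂ₘu‖₂² = ‖Δu‖₂²`,
`Torus.sum_gradNormSq_partialDeriv_eq`). -/
theorem h2NL_integral_sum_norm_partialDeriv_convect_sq_le {u : 𝕋³ → E³} (hu : IsSmooth u) {S : ℝ}
    (hS : ∀ x, ‖u x‖ ^ 2 ≤ S) :
    ∫ x, ∑ m, ‖partialDeriv m (convect u u) x‖ ^ 2 ≤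
      6 * (S * ∫ x, ‖laplacian u x‖ ^ 2) + 6 * ∫ x, (∑ i, ‖partialDeriv i u x‖ ^ 2) ^ 2 := by
  have hA : IsSmooth (convect u u) := hu.convect hu
  have hcH : ∀ m, Continuous fun x => ∑ i, ‖partialDeriv i (partialDeriv m u) x‖ ^ 2 := fun m =>
    continuous_finsetSum _ fun i _ => ((hu.partialDeriv m).partialDeriv i).continuous.norm.pow 2
  have hcHH : Continuous fun x => ∑ m, ∑ i, ‖partialDeriv i (partialDeriv m u) x‖ ^ 2 :=
    continuous_finsetSum _ fun m _ => hcH m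
  have hcθ : Continuous fun x => ∑ i, ‖partialDeriv i u x‖ ^ 2 :=
    continuous_finsetSum _ fun i _ => (hu.partialDeriv i).continuous.norm.pow 2
  have hcA : Continuous fun x => ∑ m, ‖partialDeriv m (convect u u) x‖ ^ 2 :=
    continuous_finsetSum _ fun m _ => (hA.partialDeriv m).continuous.norm.pow 2
  have hiH : Integrable (fun x => S * ∑ m, ∑ i, ‖partialDeriv i (partialDeriv m u) x‖ ^ 2) volume :=
    hcHH.integrable_unitAddTorus.const_mul S
  have hiθ : Integrable (fun x => (∑ i, ‖partialDeriv i u x‖ ^ 2) ^ 2) volume :=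
    (hcθ.pow 2).integrable_unitAddTorus
  have hH0 : ∀ x, 0 ≤ ∑ m, ∑ i, ‖partialDeriv i (partialDeriv m u) x‖ ^ 2 := fun x =>
    Finset.sum_nonneg fun m _ => Finset.sum_nonneg fun i _ => sq_nonneg _
  have hsum : ∫ x, ∑ m, ∑ i, ‖partialDeriv i (partialDeriv m u) x‖ ^ 2 = ∫ x, ‖laplacian u x‖ ^ 2 := by
    rw [integral_finsetSum _ fun m _ => (hcH m).integrable_unitAddTorus, ← sum_gradNormSq_partialDeriv_eq hu]
    rfl
  calc ∫ x, ∑ m, ‖partialDeriv m (convect u u) x‖ ^ 2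
      ≤ ∫ x, (6 * (S * ∑ m, ∑ i, ‖partialDeriv i (partialDeriv m u) x‖ ^ 2) +
          6 * (∑ i, ‖partialDeriv i u x‖ ^ 2) ^ 2) := by
        refine integral_mono hcA.integrable_unitAddTorus ((hiH.const_mul 6).add (hiθ.const_mul 6))
          fun x => ?_
        have h := h2NL_sum_norm_partialDeriv_convect_sq_le hu x
        have h' : ‖u x‖ ^ 2 * ∑ m, ∑ i, ‖partialDeriv i (partialDeriv m u) x‖ ^ 2 ≤
            S * ∑ m, ∑ i, ‖partialDeriv i (partialDeriv m u) x‖ ^ 2 :=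
          mul_le_mul_of_nonneg_right (hS x) (hH0 x)
        dsimp only
        linarith
    _ = 6 * (S * ∫ x, ‖laplacian u x‖ ^ 2) + 6 * ∫ x, (∑ i, ‖partialDeriv i u x‖ ^ 2) ^ 2 := by
        rw [integral_add (hiH.const_mul 6) (hiθ.const_mul 6), integral_const_mul, integral_const_mul,
          integral_const_mul, hsum]

/-- **The squared `H²` seminorm equals `‖Δu‖₂²`** in the double-sum form of the Sobolev embedding:
`∑ᵢ ∑ⱼ ∫ ‖∂ᵢ∂ⱼu‖² = ∫ ‖Δu‖²`. -/
theorem h2NL_sum_sum_integral_eq {u : 𝕋³ → E³} (hu : IsSmooth u) :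
    ∑ i, ∑ j, ∫ y, ‖partialDeriv i (partialDeriv j u) y‖ ^ 2 = ∫ x, ‖laplacian u x‖ ^ 2 := by
  rw [Finset.sum_comm, ← sum_gradNormSq_partialDeriv_eq hu]
  refine Finset.sum_congr rfl fun j _ => ?_
  rw [gradNormSq]
  exact (integral_finsetSum _ fun i _ =>
    (((hu.partialDeriv j).partialDeriv i).continuous.norm.pow 2).integrable_unitAddTorus).symm

/-- `∑ᵢ ∫ ‖∂ᵢu‖² = gradNormSq u`. -/
theorem h2NL_sum_integral_eq_gradNormSq {u : 𝕋³ → E³} (hu : IsSmooth u) :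
    ∑ i, ∫ y, ‖partialDeriv i u y‖ ^ 2 = gradNormSq u := by
  rw [gradNormSq]
  exact (integral_finsetSum _ fun i _ =>
    ((hu.partialDeriv i).continuous.norm.pow 2).integrable_unitAddTorus).symm

/-- Stub S3 (L) **the `H²` nonlinear estimate on `T³`**: for smooth solenoidal mean-zero `u` with `‖∇u‖₂² ≤ M`,
`|∫⟪(u·∇)u, Δ²u⟫| ≤ (ν/2)‖∇Δu‖₂² + C(1 + ‖Δu‖₂²)²` with `C = C(ν, M)`.  Proof: `∫⟪A, ΔB⟫ = −Σₘ∫⟪∂ₘA, ∂ₘB⟫` with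
`A = (u·∇)u`, `B = Δu`; `∂ₘ((u·∇)u) = (∂ₘu·∇)u + (u·∇)∂ₘu`; `‖(∂ₘu·∇)u‖₂² ≤ ∫|∇u|⁴ ≤ K‖∇u‖₂‖Δu‖₂³`
(`Torus.integral_sum_norm_sq_partialDeriv_sq_le`, Ladyzhenskaya in 3-D); `‖(u·∇)∂ₘu‖₂² ≤ ‖u‖_∞²·‖Δu‖₂²`
(`Torus.sum_gradNormSq_partialDeriv_eq`) with `‖u‖_∞² ≤ K'(‖u‖₂² + ‖∇u‖₂² + ΣΣ‖∂ᵢ∂ⱼu‖₂²) ≤ K''(M + ‖Δu‖₂²)`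
(`Torus.norm_sq_le_sobolev_two_of_isSmooth`, Poincaré `Torus.integral_norm_sq_le_card_pow_mul_gradNormSq`);
then pointwise Young.  Constantin–Foias 1988 Ch. 13; Foias–Manley–Rosa–Temam 2001 Ch. II App. A. -/
theorem stub_h2NonlinearEstimate :
    ∀ (ν M : ℝ), 0 < ν → 0 ≤ M → ∃ C : ℝ, ∀ u : 𝕋³ → E³, IsSmooth u → IsDivFree u → HasZeroMean u →
      gradNormSq u ≤ M →
      |∫ x, ⟪convect u u x, laplacian (laplacian u) x⟫_ℝ| ≤
        ν / 2 * gradNormSq (laplacian u) + C * (1 + ∫ x, ‖laplacian u x‖ ^ 2) ^ 2 := by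
  intro ν M hν hM
  obtain ⟨K₁, hK₁⟩ := integral_sum_norm_sq_partialDeriv_sq_le (d := Fin 3) (Fintype.card_fin 3)
  obtain ⟨K₂, hK₂pos, hK₂⟩ :=
    norm_sq_le_sobolev_two_of_isSmooth (d := Fin 3) (F' := E³) (Fintype.card_fin 3)
  refine ⟨(3 * K₂ * (28 * M + 1) + 3 * K₁ * M ^ (1 / 2 : ℝ)) / ν, fun u hu _hdiv hzm hgrad => ?_⟩
  have hK₁0 : (0 : ℝ) ≤ K₁ := NNReal.coe_nonneg K₁
  have hK₂0 : 0 ≤ K₂ := hK₂pos.le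
  have hA : IsSmooth (convect u u) := hu.convect hu
  have hB : IsSmooth (laplacian u) := hu.laplacian
  have hL0 : 0 ≤ ∫ x, ‖laplacian u x‖ ^ 2 := integral_nonneg fun x => sq_nonneg _
  have hG0 : 0 ≤ gradNormSq u := gradNormSq_nonneg u
  -- ### Step 1: Green's identity, as one integral
  have hint : ∀ m, Integrable (fun x => ⟪partialDeriv m (convect u u) x,
      partialDeriv m (laplacian u) x⟫_ℝ) volume :=
    fun m => ((hA.partialDeriv m).inner (hB.partialDeriv m)).integrable
  have hI : ∫ x, ⟪convect u u x, laplacian (laplacian u) x⟫_ℝ =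
      -∫ x, ∑ m, ⟪partialDeriv m (convect u u) x, partialDeriv m (laplacian u) x⟫_ℝ := by
    rw [integral_finsetSum _ fun m _ => hint m,
      Torus.sum_integral_inner_partialDeriv_eq_neg_integral_inner_laplacian hA hB, neg_neg]
  -- ### Step 2: pointwise Young
  have hpt : ∀ x, |∑ m, ⟪partialDeriv m (convect u u) x, partialDeriv m (laplacian u) x⟫_ℝ| ≤
      ν / 2 * ∑ m, ‖partialDeriv m (laplacian u) x‖ ^ 2 +
        1 / (2 * ν) * ∑ m, ‖partialDeriv m (convect u u) x‖ ^ 2 := by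
    intro x
    calc |∑ m, ⟪partialDeriv m (convect u u) x, partialDeriv m (laplacian u) x⟫_ℝ|
        ≤ ∑ m, |⟪partialDeriv m (convect u u) x, partialDeriv m (laplacian u) x⟫_ℝ| :=
          Finset.abs_sum_le_sum_abs _ _
      _ ≤ ∑ m, (ν / 2 * ‖partialDeriv m (laplacian u) x‖ ^ 2 +
            1 / (2 * ν) * ‖partialDeriv m (convect u u) x‖ ^ 2) :=
          Finset.sum_le_sum fun m _ => (abs_real_inner_le_norm _ _).trans (h2NL_young hν _ _)
      _ = ν / 2 * ∑ m, ‖partialDeriv m (laplacian u) x‖ ^ 2 +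
            1 / (2 * ν) * ∑ m, ‖partialDeriv m (convect u u) x‖ ^ 2 := by
          rw [Finset.sum_add_distrib, ← Finset.mul_sum, ← Finset.mul_sum]
  -- ### Step 3: integrate
  have hcB : Continuous fun x => ∑ m, ‖partialDeriv m (laplacian u) x‖ ^ 2 :=
    continuous_finsetSum _ fun m _ => (hB.partialDeriv m).continuous.norm.pow 2
  have hcA : Continuous fun x => ∑ m, ‖partialDeriv m (convect u u) x‖ ^ 2 :=
    continuous_finsetSum _ fun m _ => (hA.partialDeriv m).continuous.norm.pow 2
  have h3 : |∫ x, ⟪convect u u x, laplacian (laplacian u) x⟫_ℝ| ≤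
      ν / 2 * gradNormSq (laplacian u) +
        1 / (2 * ν) * ∫ x, ∑ m, ‖partialDeriv m (convect u u) x‖ ^ 2 := by
    rw [hI, abs_neg]
    calc |∫ x, ∑ m, ⟪partialDeriv m (convect u u) x, partialDeriv m (laplacian u) x⟫_ℝ|
        ≤ ∫ x, |∑ m, ⟪partialDeriv m (convect u u) x, partialDeriv m (laplacian u) x⟫_ℝ| :=
          abs_integral_le_integral_abs
      _ ≤ ∫ x, (ν / 2 * ∑ m, ‖partialDeriv m (laplacian u) x‖ ^ 2 +
            1 / (2 * ν) * ∑ m, ‖partialDeriv m (convect u u) x‖ ^ 2) :=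
          integral_mono (integrable_finsetSum _ fun m _ => hint m).abs
            ((hcB.integrable_unitAddTorus.const_mul _).add (hcA.integrable_unitAddTorus.const_mul _)) hpt
      _ = ν / 2 * gradNormSq (laplacian u) +
            1 / (2 * ν) * ∫ x, ∑ m, ‖partialDeriv m (convect u u) x‖ ^ 2 := by
          rw [integral_add (hcB.integrable_unitAddTorus.const_mul _)
            (hcA.integrable_unitAddTorus.const_mul _), integral_const_mul, integral_const_mul, gradNormSq]
  -- ### Step 4: the sup bound `‖u x‖² ≤ K₂ (28 M + L)`
  have hP : ∫ x, ‖u x‖ ^ 2 ≤ 27 * M := by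
    have h := integral_norm_sq_le_card_pow_mul_gradNormSq hu hzm
    rw [Fintype.card_fin] at h
    calc ∫ x, ‖u x‖ ^ 2 ≤ ((3 : ℕ) : ℝ) ^ 3 * gradNormSq u := h
      _ ≤ ((3 : ℕ) : ℝ) ^ 3 * M := mul_le_mul_of_nonneg_left hgrad (by positivity)
      _ = 27 * M := by norm_num
  have hS : ∀ x, ‖u x‖ ^ 2 ≤ K₂ * (28 * M + ∫ x, ‖laplacian u x‖ ^ 2) := by
    intro x
    have h := hK₂ u hu x
    rw [h2NL_sum_sum_integral_eq hu, h2NL_sum_integral_eq_gradNormSq hu] at h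
    refine h.trans (mul_le_mul_of_nonneg_left ?_ hK₂0)
    linarith
  -- ### Step 5: `∫ ∑ₘ ‖∂ₘA‖² ≤ 6 K₂ (28M + L) L + 6 K₁ M^{1/2} L^{3/2} ≤ 6 (K₂ (28M+1) + K₁ M^{1/2}) (1+L)²`
  have h5 := h2NL_integral_sum_norm_partialDeriv_convect_sq_le hu hS
  have hθ : ∫ x, (∑ i, ‖partialDeriv i u x‖ ^ 2) ^ 2 ≤
      K₁ * M ^ (1 / 2 : ℝ) * (1 + ∫ x, ‖laplacian u x‖ ^ 2) ^ 2 := by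
    have h := hK₁ u hu
    have h1 : gradNormSq u ^ (1 / 2 : ℝ) ≤ M ^ (1 / 2 : ℝ) := Real.rpow_le_rpow hG0 hgrad (by norm_num)
    have h2 : (∫ x, ‖laplacian u x‖ ^ 2) ^ (3 / 2 : ℝ) ≤ (1 + ∫ x, ‖laplacian u x‖ ^ 2) ^ 2 := by
      calc (∫ x, ‖laplacian u x‖ ^ 2) ^ (3 / 2 : ℝ) ≤ (1 + ∫ x, ‖laplacian u x‖ ^ 2) ^ (3 / 2 : ℝ) :=
            Real.rpow_le_rpow hL0 (by linarith) (by norm_num)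
        _ ≤ (1 + ∫ x, ‖laplacian u x‖ ^ 2) ^ (2 : ℝ) :=
            Real.rpow_le_rpow_of_exponent_le (by linarith) (by norm_num)
        _ = (1 + ∫ x, ‖laplacian u x‖ ^ 2) ^ 2 := Real.rpow_two _
    exact h.trans (mul_le_mul (mul_le_mul_of_nonneg_left h1 hK₁0) h2 (Real.rpow_nonneg hL0 _)
      (mul_nonneg hK₁0 (Real.rpow_nonneg hM _)))
  have hSL : K₂ * (28 * M + ∫ x, ‖laplacian u x‖ ^ 2) * ∫ x, ‖laplacian u x‖ ^ 2 ≤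
      K₂ * (28 * M + 1) * (1 + ∫ x, ‖laplacian u x‖ ^ 2) ^ 2 := by
    have hL1 : (∫ x, ‖laplacian u x‖ ^ 2) ≤ (1 + ∫ x, ‖laplacian u x‖ ^ 2) ^ 2 := by nlinarith
    have hL2 : (∫ x, ‖laplacian u x‖ ^ 2) ^ 2 ≤ (1 + ∫ x, ‖laplacian u x‖ ^ 2) ^ 2 := by nlinarith
    have hML : 28 * M * (∫ x, ‖laplacian u x‖ ^ 2) ≤ 28 * M * (1 + ∫ x, ‖laplacian u x‖ ^ 2) ^ 2 :=
      mul_le_mul_of_nonneg_left hL1 (by positivity)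
    have h' : (28 * M + ∫ x, ‖laplacian u x‖ ^ 2) * ∫ x, ‖laplacian u x‖ ^ 2 ≤
        (28 * M + 1) * (1 + ∫ x, ‖laplacian u x‖ ^ 2) ^ 2 := by nlinarith
    calc K₂ * (28 * M + ∫ x, ‖laplacian u x‖ ^ 2) * ∫ x, ‖laplacian u x‖ ^ 2
        = K₂ * ((28 * M + ∫ x, ‖laplacian u x‖ ^ 2) * ∫ x, ‖laplacian u x‖ ^ 2) := by ring
      _ ≤ K₂ * ((28 * M + 1) * (1 + ∫ x, ‖laplacian u x‖ ^ 2) ^ 2) :=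
          mul_le_mul_of_nonneg_left h' hK₂0
      _ = K₂ * (28 * M + 1) * (1 + ∫ x, ‖laplacian u x‖ ^ 2) ^ 2 := by ring
  have hX : ∫ x, ∑ m, ‖partialDeriv m (convect u u) x‖ ^ 2 ≤
      6 * (K₂ * (28 * M + 1) * (1 + ∫ x, ‖laplacian u x‖ ^ 2) ^ 2) +
        6 * (K₁ * M ^ (1 / 2 : ℝ) * (1 + ∫ x, ‖laplacian u x‖ ^ 2) ^ 2) := by
    linarith
  -- ### assembly
  have hfin : 1 / (2 * ν) * ∫ x, ∑ m, ‖partialDeriv m (convect u u) x‖ ^ 2 ≤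
      (3 * K₂ * (28 * M + 1) + 3 * K₁ * M ^ (1 / 2 : ℝ)) / ν * (1 + ∫ x, ‖laplacian u x‖ ^ 2) ^ 2 := by
    have h := mul_le_mul_of_nonneg_left hX (by positivity : (0 : ℝ) ≤ 1 / (2 * ν))
    have e : 1 / (2 * ν) * (6 * (K₂ * (28 * M + 1) * (1 + ∫ x, ‖laplacian u x‖ ^ 2) ^ 2) +
        6 * (K₁ * M ^ (1 / 2 : ℝ) * (1 + ∫ x, ‖laplacian u x‖ ^ 2) ^ 2)) =
        (3 * K₂ * (28 * M + 1) + 3 * K₁ * M ^ (1 / 2 : ℝ)) / ν * (1 + ∫ x, ‖laplacian u x‖ ^ 2) ^ 2 := by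
      field_simp
      ring
    linarith
  linarith

end Summit.AnomalousDissipation.AnomalousDissipation.Theorems.ChainRealisation.SeparatrixFluxPinning

end
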